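import Summits.HodgeConjecture.HodgeConjecture.Cruxes.BlochSeedDiscOne.SeedCheckerSplitBlockPicZeroPin

/-!
line stmt-HodgeConjecture-18881 Cruxes/BlochSeedDiscOne/Lines/birth.lean 814a6a70c14e831a stub_rung_pad4_seedAt

# SeedCheckerSplitBlockQ1Shell — the (Q1-SHELL) of director-hodge g33 R19.901 (optional docket to hsemireg-c5c8-1 g55, 2026-08-31): THEOREM Q1 of
# plan-lens-HodgeAV-negation g26 (memo v1.5 §4quinquies; officer idea-crit-6 g29 READ #10 (f) PASS ×2, bus l.13961) TYPED-NOT-PROVED as a named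
# `Prop`, and the sorry-free ONE-CITATION REDUCTION «Q1 ⟹ (the PP row's statement ⟹ the LEG row's statement)» in three forms — generic (any law `Λ`,
# any height `h`: `Rung2b₀Under Λ h lawPP → Rung2b₀Under Λ h HallPlusLegUp`), the v3 literal (guard `originLaw`, = `Lines/splitblock.lean` v3
# 913fcfc89bbd08ef `stub_ppRow` ∕ `stub_legRow` signatures verbatim) and the v4 literal (guard `originPicZeroLaw`, R19.900 (R-a)).  ADDITIVE vocabulary
# file: imports only v42.4 `SeedCheckerSplitBlockPicZeroPin` (65704d1ec475419c, BUILT); touches no `Lines/*`, redeclares nothing.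
# `TheoremQ1` is NOT a stub, NOT a hypothesis of any record, NOT registered anywhere (R19.901: «so that a future kernel `q1` closes `stub_legRow` by one
# citation»; officer (acc): `stub_legRow` stays its own sorried stub until then).

USE (for the `cruxplan-18881-splitblock` lead, once a kernel proof `q1 : TheoremQ1` lands in a sorry-free module): `stub_legRow := legRow_of_ppRow_of_q1
q1 stub_ppRow` (v3 guard) ∕ `legRow_of_ppRow_of_q1_picZero q1 stub_ppRow` (v4 guard) ∕ `rung2b₀Under_legRow_of_ppRow_of_q1 q1 rung2b₀Under_ppRow` (record
form).  DIRECTION OF RECORD: Q1 is `PPClean weakB ⟹ HallPlusLegUp`; the converse FAILS (tree: `PortHallRho.rho_row_separates_MIXB :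
HallPlusLegUp MIXB ∧ ¬ HallPlusRhoUp MIXB ∧ ¬ PPClean weakB MIXB`, `PortHallRhoRow.lean`), so the PP row is the STRONGER of the two and nothing here lets the
leg row close the PP row.

HONEST REGISTER.  One named `Prop` and four one-line implications; `TheoremQ1` remains OPEN in the tree (pen PASS ×2, kernel 0); nothing here proves or
refutes `stub_ppRow`, `stub_legRow`, `stub_rung2a`, `Rung2a₀ 14`, 18881, 18880, 30548, 19780, 27388, № 4, H2, HC_AV, HC_CM or HC; typed ≠ proved;
registered ≠ closed.  No `sorry`, no new axiom, no `instance`, no notation.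
-/

set_option linter.dupNamespace false
set_option autoImplicit false

open CategoryTheory AlgebraicGeometry
open Literature.AlgebraicGeometry Literature.AlgebraicGeometry.Motives Literature.AlgebraicGeometry.HodgeTheory
open Literature.AlgebraicTopology.SingularHomology

namespace Summit.HodgeConjecture.HodgeConjecture.Cruxes.BlochSeedDiscOne.SeedChecker

open Summit.HodgeConjecture.HodgeConjecture.Cruxes.BlochSeedDiscOne.Anchor
open Summit.Ventures.HSemireg Summit.Ventures.HSemireg.Pad4Tower

namespace SplitBlock

section Q1Shell

/-- **THEOREM Q1 (plan-lens-HodgeAV-negation g26, memo v1.5 §4quinquies; officer READ #10 (f) PASS ×2 as (a) ⟹ (c) ⟹ LEMMA L; director R19.901 literal)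
— TYPED, NOT PROVED; not a stub, not a hypothesis of any record.**  For EVERY letter design `D` (cells are classes; `weakB` ∕ `pairDim` are computed from
them, so one realisation — by the origin letter bundles on `X′` — suffices, scope sentence (q1)): PP-cleanness for the weak arrow relation implies Hall's
count with the leg surplus.  One-column case: settled (pen ×1 + machine ×2); multi-column (MS): pen PASS ×2, 7 252 + 1 000 supporting instances, 0 against.
[pen; negation memo v1.5 §4quinquies] -/
def TheoremQ1 : Prop :=
  ∀ D : DepthBoundA4.Design, PatternedPorteous.PPClean PatternedPorteous.weakB D → PortHallLeg.HallPlusLegUp D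

/-- Q1 read through the row name of record `lawPP` (v42.1 `SeedCheckerSplitBlockCFree`: `lawPP D := PPClean weakB D`, definitionally). -/
theorem TheoremQ1.hallPlusLegUp_of_lawPP (q1 : TheoremQ1) {D : DepthBoundA4.Design} (h : lawPP D) : PortHallLeg.HallPlusLegUp D :=
  q1 D h

/-- **GENERIC ONE-CITATION REDUCTION** (any law `Λ`, any height `h`): Q1 turns the PP row of record into the LEG row of record. -/
theorem rung2b₀Under_legRow_of_ppRow_of_q1 (q1 : TheoremQ1) {Λ : DatumLaw} {h : ℤ} (hpp : Rung2b₀Under Λ h lawPP) :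
    Rung2b₀Under Λ h PortHallLeg.HallPlusLegUp :=
  rung2b₀Under_mono (fun D hD => q1 D hD) hpp

/-- **`legRow_of_ppRow_of_q1` — the v3 LITERAL** (guard `originLaw`; antecedent = `Lines/splitblock.lean` v3 `stub_ppRow`'s statement verbatim, conclusion =
`stub_legRow`'s statement verbatim): `TheoremQ1 → stub_ppRow-statement → stub_legRow-statement`. -/
theorem legRow_of_ppRow_of_q1 (q1 : TheoremQ1)
    (hpp : ∀ (E₀ : AbelianVariety ℂ) (ψ₀ : E₀ ⟶ E₀), E₀.dim = 1 → ψ₀ ≫ ψ₀ = -(1 • 𝟙 E₀) →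
      ∀ δ : SplitBlockDatum₀ E₀ ψ₀, originLaw E₀ ψ₀ δ → δ.Dsh.Positive → δ.Passes → ScopeRows 14 δ.Dsh.shadow →
        lawPP δ.Dsh.shadow) :
    ∀ (E₀ : AbelianVariety ℂ) (ψ₀ : E₀ ⟶ E₀), E₀.dim = 1 → ψ₀ ≫ ψ₀ = -(1 • 𝟙 E₀) →
      ∀ δ : SplitBlockDatum₀ E₀ ψ₀, originLaw E₀ ψ₀ δ → δ.Dsh.Positive → δ.Passes → ScopeRows 14 δ.Dsh.shadow →
        PortHallLeg.HallPlusLegUp δ.Dsh.shadow :=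
  fun E₀ ψ₀ hE hψ δ hΛ hpos hδ hsc => q1 _ (hpp E₀ ψ₀ hE hψ δ hΛ hpos hδ hsc)

/-- **`legRow_of_ppRow_of_q1_picZero` — the v4 LITERAL** (guard `originPicZeroLaw`, the (R-a) re-guard of R19.900 ∕ R19.901; same shape). -/
theorem legRow_of_ppRow_of_q1_picZero (q1 : TheoremQ1)
    (hpp : ∀ (E₀ : AbelianVariety ℂ) (ψ₀ : E₀ ⟶ E₀), E₀.dim = 1 → ψ₀ ≫ ψ₀ = -(1 • 𝟙 E₀) →
      ∀ δ : SplitBlockDatum₀ E₀ ψ₀, originPicZeroLaw E₀ ψ₀ δ → δ.Dsh.Positive → δ.Passes → ScopeRows 14 δ.Dsh.shadow →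
        lawPP δ.Dsh.shadow) :
    ∀ (E₀ : AbelianVariety ℂ) (ψ₀ : E₀ ⟶ E₀), E₀.dim = 1 → ψ₀ ≫ ψ₀ = -(1 • 𝟙 E₀) →
      ∀ δ : SplitBlockDatum₀ E₀ ψ₀, originPicZeroLaw E₀ ψ₀ δ → δ.Dsh.Positive → δ.Passes → ScopeRows 14 δ.Dsh.shadow →
        PortHallLeg.HallPlusLegUp δ.Dsh.shadow :=
  fun E₀ ψ₀ hE hψ δ hΛ hpos hδ hsc => q1 _ (hpp E₀ ψ₀ hE hψ δ hΛ hpos hδ hsc)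

/-- the v3 literal IS the generic reduction at `Λ := originLaw`, `h := 14` (definitional check that the literal and the record form agree). -/
theorem legRow_of_ppRow_of_q1_eq_generic (q1 : TheoremQ1) (hpp : Rung2b₀Under originLaw 14 lawPP) :
    Rung2b₀Under originLaw 14 PortHallLeg.HallPlusLegUp :=
  legRow_of_ppRow_of_q1 q1 hpp

/-- same at the v4 guard. -/
theorem legRow_of_ppRow_of_q1_picZero_eq_generic (q1 : TheoremQ1) (hpp : Rung2b₀Under originPicZeroLaw 14 lawPP) :
    Rung2b₀Under originPicZeroLaw 14 PortHallLeg.HallPlusLegUp :=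
  legRow_of_ppRow_of_q1_picZero q1 hpp

/-- AUDIT: nothing on the path of 18881 is decided in this file. -/
theorem audit_nothing_decided_q1Shell : True := trivial

end Q1Shell

end SplitBlock

end Summit.HodgeConjecture.HodgeConjecture.Cruxes.BlochSeedDiscOne.SeedChecker
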